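import Mathlib
import HarnessLib
import Literature.Computability.Complexity.Space
import Literature.Computability.Complexity.TimeBoundsProofs
import Literature.Computability.Complexity.TM2PassThrough
import Literature.Computability.MetaComplexity.Magnification
import Summits.PneNP.PneNP.Theorems.UniformStreamUniformStreamLBStubDispatch
import Summits.PneNP.PneNP.Theorems.UniformStreamUniformStreamLBStubIncrementer
import Summits.PneNP.PneNP.Theorems.UniformStreamUniformStreamLBStubPairFormer
import Summits.PneNP.PneNP.Theorems.UniformStreamUniformStreamLBStubStreamLoop

/-!
# Uniform one-pass streaming is a small simultaneous time–space class (`stub_simulation`)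

Route `UniformStream`, crux `UniformStreamLB` (stmt-PneNP-16045), line `birth`: the registered stub
`stub_simulation` (`--supports stmt-PneNP-16045`), the SIMULATION half of the transfer of the crux to
`DTISP`.

**Theorem (`stub_simulation`).** Let `S : ℕ → ℕ` and let `L ⊆ {0,1}*` be decided by a UNIFORM one-pass
streaming algorithm `A` within budget `S`: ONE Mathlib `TM2` machine each — quantified before `∀ N` —
computes the initial state from `encodeNat N` (`M₀`), the update `boolPair st [b] ↦ A.update N st b` on
all states of length `≤ S N` (`M₁`) and the verdict `st ↦ [A.accept N st]` (`M₂`), each within `S N`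
steps, and all states have length `≤ S N` (`A.HasSpace S`). Then
`L ∈ DTISP((N+1)·(S N + ⌊log₂N⌋ + 1), S N + ⌊log₂N⌋ + 1)` (the tree's `DTISP`, one input-preserving
`SpaceMachine`, Arora–Barak 2009, Def. 5.10).

*Proof.* Merge the binary incrementer (`stub_incrementer`), `M₀`, `pairFormer ∘ M₁`
(`stub_pairFormer`, `Turing.TM2ComputableAux.comp`) and `M₂` into ONE round machine by nesting the
two-way dispatch combinator (`stub_dispatch`) twice (`dispatch4`, tags `00/01/10/11`); every round then
costs at most `C·X N` steps with `X N = S N + ⌊log₂N⌋ + 1 ≥ 1` and one machine-dependent constant `C`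
(`lin_bound`; binary numerals of `n ≤ N` have length `≤ ⌊log₂N⌋ + 1`, `length_encodeNat_le_log`), and the
generic streaming loop (`stub_streamLoop`: count the input in binary while moving the read-only head,
rewind, init, one update round per bit, accept) puts `L` in `DTISP(N·CX + CX, CX)`, which is the stated
class up to the constant (`dtisp_mono_const`). This is the in-tree content of "uniform streaming is a
SMALL UNIFORM class" (McKay–Murray–Williams 2019, §2; Cheraghchi–Hirahara–Myrisiotis–Yoshida 2022,
Lemma 10 is the one-tape analogue).

## References

* D. M. McKay, C. D. Murray, R. R. Williams, *Weak lower bounds on resource-bounded compression imply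
  strong separations of complexity classes*, STOC 2019, §2 (the streaming model). [MckayMurrayWilliams2019]
* S. Arora, B. Barak, *Computational Complexity: A Modern Approach*, CUP 2009, §1.3 (machines as
  subroutines), Def. 4.1, Def. 5.10 (TISP). [AroraBarak2009]
* M. Cheraghchi, S. Hirahara, D. Myrisiotis, Y. Yoshida, *One-tape Turing machine and branching program
  lower bounds for MCSP*, Theory Comput. Syst. 2022, Lemma 10. [CheraghchiEtAl2022]
-/

set_option linter.dupNamespace false -- `Summit.PneNP.PneNP.…`: summit = sub-problem (D-0017)

noncomputable section

namespace Summit.PneNP.PneNP.Theorems.UniformStreamLB.Birth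

open Literature.Computability.Complexity Literature.Computability.MetaComplexity

namespace Simulation

/-- Length of a binary numeral: `|encodeNat n| ≤ ⌊log₂ N⌋ + 1` for `n ≤ N`. [folklore] -/
theorem length_encodeNat_le_log {n N : ℕ} (h : n ≤ N) :
    (Computability.encodeNat n).length ≤ Nat.log 2 N + 1 := by
  rw [TM2Pass.length_encodeNat_eq_size]
  exact Nat.size_le.2 (lt_of_le_of_lt h (Nat.lt_pow_succ_log_self Nat.one_lt_two N))

/-- Linear bookkeeping: `d·(m + n) + d ≤ d·(C₁ + C₂ + 1)·X` when `m ≤ C₁ X`, `n ≤ C₂ X`, `X ≥ 1`.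
[folklore] -/
theorem lin_bound {d m n C₁ C₂ X : ℕ} (hX : 1 ≤ X) (hm : m ≤ C₁ * X) (hn : n ≤ C₂ * X) :
    d * (m + n) + d ≤ d * (C₁ + C₂ + 1) * X := by
  calc d * (m + n) + d ≤ d * (C₁ * X + C₂ * X) + d * X := by gcongr; simpa using Nat.le_mul_of_pos_right d hX
    _ = d * (C₁ + C₂ + 1) * X := by ring

/-- Nesting two dispatch budgets. [folklore] -/
theorem nest_bound (d₁ d₃ m n : ℕ) :
    d₃ * ((d₁ * (m + n) + d₁) + (n + 1)) + d₃ ≤ (d₃ * (d₁ + 2)) * (m + n) + d₃ * (d₁ + 2) := by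
  nlinarith [Nat.zero_le (d₃ * m), Nat.zero_le (d₃ * n)]

/-- The four-way round machine: nesting `stub_dispatch` twice (tags `00`, `01`, `10`, `11`).
[Arora–Barak 2009, §1.3] [folklore] -/
theorem dispatch4 (M00 M01 M10 M11 : Turing.TM2ComputableAux Bool Bool) :
    ∃ (M : Turing.TM2ComputableAux Bool Bool) (d : ℕ),
      ∀ (w out : List Bool) (m : ℕ),
        (M00.OutputsWithin w out m →
          M.OutputsWithin (false :: false :: w) out (d * (m + w.length) + d)) ∧
        (M01.OutputsWithin w out m →
          M.OutputsWithin (false :: true :: w) out (d * (m + w.length) + d)) ∧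
        (M10.OutputsWithin w out m →
          M.OutputsWithin (true :: false :: w) out (d * (m + w.length) + d)) ∧
        (M11.OutputsWithin w out m →
          M.OutputsWithin (true :: true :: w) out (d * (m + w.length) + d)) := by
  obtain ⟨P, d₁, hP⟩ := stub_dispatch M00 M01
  obtain ⟨P', d₂, hP'⟩ := stub_dispatch M10 M11
  obtain ⟨Q, d₃, hQ⟩ := stub_dispatch P P'
  refine ⟨Q, d₃ * (d₁ + d₂ + 2), fun w out m => ⟨fun h => ?_, fun h => ?_, fun h => ?_, fun h => ?_⟩⟩
  · refine (((hQ (false :: w) out _).1 ((hP w out m).1 h))).mono ?_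
    simp only [List.length_cons]
    calc d₃ * (d₁ * (m + w.length) + d₁ + (w.length + 1)) + d₃
        ≤ (d₃ * (d₁ + 2)) * (m + w.length) + d₃ * (d₁ + 2) := nest_bound d₁ d₃ m w.length
      _ ≤ d₃ * (d₁ + d₂ + 2) * (m + w.length) + d₃ * (d₁ + d₂ + 2) := by gcongr <;> omega
  · refine (((hQ (true :: w) out _).1 ((hP w out m).2 h))).mono ?_
    simp only [List.length_cons]
    calc d₃ * (d₁ * (m + w.length) + d₁ + (w.length + 1)) + d₃
        ≤ (d₃ * (d₁ + 2)) * (m + w.length) + d₃ * (d₁ + 2) := nest_bound d₁ d₃ m w.length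
      _ ≤ d₃ * (d₁ + d₂ + 2) * (m + w.length) + d₃ * (d₁ + d₂ + 2) := by gcongr <;> omega
  · refine (((hQ (false :: w) out _).2 ((hP' w out m).1 h))).mono ?_
    simp only [List.length_cons]
    calc d₃ * (d₂ * (m + w.length) + d₂ + (w.length + 1)) + d₃
        ≤ (d₃ * (d₂ + 2)) * (m + w.length) + d₃ * (d₂ + 2) := nest_bound d₂ d₃ m w.length
      _ ≤ d₃ * (d₁ + d₂ + 2) * (m + w.length) + d₃ * (d₁ + d₂ + 2) := by gcongr <;> omega
  · refine (((hQ (true :: w) out _).2 ((hP' w out m).2 h))).mono ?_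
    simp only [List.length_cons]
    calc d₃ * (d₂ * (m + w.length) + d₂ + (w.length + 1)) + d₃
        ≤ (d₃ * (d₂ + 2)) * (m + w.length) + d₃ * (d₂ + 2) := nest_bound d₂ d₃ m w.length
      _ ≤ d₃ * (d₁ + d₂ + 2) * (m + w.length) + d₃ * (d₁ + d₂ + 2) := by gcongr <;> omega

/-- Monotonicity of the exact time–space class in both bounds. [Arora–Barak 2009, Def. 5.10]
[folklore] -/
theorem tsClass_mono {t t' s s' : ℕ → ℕ} (ht : ∀ n, t n ≤ t' n) (hs : ∀ n, s n ≤ s' n) :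
    TimeSpaceClass t s ⊆ TimeSpaceClass t' s' := by
  rintro L ⟨M, hM⟩
  exact ⟨M, hM.1, fun x => ⟨(hM.2 x).1.imp fun c hc => hc.mono (ht _), (hM.2 x).2.mono (hs _)⟩⟩

/-- Monotonicity of `DTISP` up to a constant: pointwise `t ≤ K·t' + K` and `s ≤ K·s' + K` give
`DTISP t s ⊆ DTISP t' s'` (the class constant absorbs `K`). [Arora–Barak 2009, Def. 5.10]
[folklore] -/
theorem dtisp_mono_const {t t' s s' : ℕ → ℕ} (K : ℕ) (ht : ∀ n, t n ≤ K * t' n + K)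
    (hs : ∀ n, s n ≤ K * s' n + K) : DTISP t s ⊆ DTISP t' s' := by
  rintro L ⟨c, hc⟩
  refine ⟨c * K + c, tsClass_mono (fun n => ?_) (fun n => ?_) hc⟩
  · have h := ht n
    calc c * t n + c ≤ c * (K * t' n + K) + c := by gcongr
      _ = (c * K) * t' n + (c * K + c) := by ring
      _ ≤ (c * K + c) * t' n + (c * K + c) := by gcongr; exact Nat.le_add_right _ _
  · have h := hs n
    calc c * s n + c ≤ c * (K * s' n + K) + c := by gcongr
      _ = (c * K) * s' n + (c * K + c) := by ring
      _ ≤ (c * K + c) * s' n + (c * K + c) := by gcongr; exact Nat.le_add_right _ _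

end Simulation

open Simulation in
/-- **THE SIMULATION (glue of Stubs A–D): uniform one-pass streaming within budget `S` is inside
`DTISP((N+1)·(S N + ⌊log₂N⌋ + 1), S N + ⌊log₂N⌋ + 1)`.** The round machine is the four-way dispatch
of the incrementer, `M₀`, `pairFormer ∘ M₁` and `M₂`; the generic streaming loop (Stub D) runs it
with all round budgets bounded by `C·(S N + ⌊log₂N⌋ + 1)` for one machine-dependent constant `C`.
[McKay–Murray–Williams 2019, §2 (streaming model); Arora–Barak 2009, Def. 5.10 (TISP), §1.3]
[folklore] -/
theorem stub_simulation :
    ∀ (S : ℕ → ℕ) (L : Language Bool),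
      (∃ (A : Literature.Computability.MetaComplexity.StreamingAlgorithm)
          (M₀ M₁ M₂ : Turing.TM2ComputableAux Bool Bool),
        A.HasSpace S ∧
        (∀ N : ℕ, M₀.OutputsWithin (Computability.encodeNat N) (A.init N) (S N)) ∧
        (∀ (N : ℕ) (st : List Bool) (b : Bool), st.length ≤ S N →
          M₁.OutputsWithin (Literature.Computability.Complexity.boolPair st [b]) (A.update N st b) (S N)) ∧
        (∀ (N : ℕ) (st : List Bool), st.length ≤ S N →
          M₂.OutputsWithin st (Computability.encodeBool (A.accept N st)) (S N)) ∧
        A.Decides L) →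
      L ∈ Literature.Computability.Complexity.DTISP (fun N => (N + 1) * (S N + Nat.log 2 N + 1))
        (fun N => S N + Nat.log 2 N + 1) := by
  intro S L h
  obtain ⟨A, M₀, M₁, M₂, hsp, h₀, h₁, h₂, hdec⟩ := h
  obtain ⟨Minc, dB, hinc⟩ := stub_incrementer
  obtain ⟨R, dC, hR⟩ := stub_pairFormer
  obtain ⟨M, d, hM⟩ := dispatch4 Minc M₀ (R.comp M₁) M₂
  -- the common budget unit `X N = S N + ⌊log₂ N⌋ + 1 ≥ 1` and the constant `C ≥ 1`
  set X : ℕ → ℕ := fun N => S N + Nat.log 2 N + 1 with hX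
  have hX1 : ∀ N, 1 ≤ X N := fun N => Nat.succ_le_succ (Nat.zero_le _)
  have hSX : ∀ N, S N ≤ X N := fun N => by simp only [hX]; omega
  have hlogX : ∀ N, Nat.log 2 N + 1 ≤ X N := fun N => by simp only [hX]; omega
  set C : ℕ := d * (2 * dB + 2 * dC + 3) + 1 with hC
  have hC1 : ∀ {a N : ℕ}, a ≤ d * (2 * dB + 2 * dC + 3) * X N → a ≤ C * X N := fun {a N} ha =>
    ha.trans (by simp only [hC]; nlinarith [hX1 N])
  have hmono : ∀ (N : ℕ) {k : ℕ}, k ≤ 2 * dB + 2 * dC + 3 →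
      d * k * X N ≤ d * (2 * dB + 2 * dC + 3) * X N := fun N k hk =>
    Nat.mul_le_mul_right _ (Nat.mul_le_mul_left _ hk)
  -- Stub D applied to the round machine
  have key := stub_streamLoop M (fun n => Computability.encodeNat n) A.init A.update A.accept S
    (fun N => C * X N) L rfl ?_ ?_ ?_ (fun N => (hsp N).1) (fun N st b hst => (hsp N).2 st b hst)
    ?_ ?_ ?_ (fun x => hdec x)
  · -- rescale `DTISP (N·B + B) B` with `B = C·X` into the target class
    refine dtisp_mono_const C (fun N => ?_) (fun N => ?_) key
    · show N * (C * X N) + C * X N ≤ C * ((N + 1) * X N) + C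
      nlinarith
    · show C * X N ≤ C * X N + C
      omega
  · -- lengths of the counting words
    intro N n hn
    calc (Computability.encodeNat n).length ≤ Nat.log 2 N + 1 := length_encodeNat_le_log hn
      _ ≤ X N := hlogX N
      _ ≤ C * X N := Nat.le_mul_of_pos_left _ (by omega)
  · -- COUNT rounds: the incrementer behind tag `00`
    intro N n hn
    have h := (hM _ _ _).1 (hinc n)
    refine h.mono (hC1 ?_)
    have hℓ : (Computability.encodeNat n).length ≤ X N :=
      (length_encodeNat_le_log hn.le).trans (hlogX N)
    have hm : dB * (Computability.encodeNat n).length + dB ≤ 2 * dB * X N := by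
      have h1 : dB * (Computability.encodeNat n).length ≤ dB * X N := Nat.mul_le_mul_left dB hℓ
      have h2 : dB ≤ dB * X N := Nat.le_mul_of_pos_right dB (hX1 N)
      calc dB * (Computability.encodeNat n).length + dB ≤ dB * X N + dB * X N := by omega
        _ = 2 * dB * X N := by ring
    calc d * (dB * (Computability.encodeNat n).length + dB + (Computability.encodeNat n).length) + d
        ≤ d * (2 * dB + 1 + 1) * X N :=
          lin_bound (C₁ := 2 * dB) (C₂ := 1) (hX1 N) hm (by simpa using hℓ)
      _ ≤ d * (2 * dB + 2 * dC + 3) * X N := hmono N (by omega)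
  · -- INIT round: `M₀` behind tag `01`
    intro N
    have h := (hM _ _ _).2.1 (h₀ N)
    refine h.mono (hC1 ?_)
    have hℓ : (Computability.encodeNat N).length ≤ X N :=
      (length_encodeNat_le_log le_rfl).trans (hlogX N)
    calc d * (S N + (Computability.encodeNat N).length) + d ≤ d * (1 + 1 + 1) * X N :=
          lin_bound (C₁ := 1) (C₂ := 1) (hX1 N) (by simpa using hSX N) (by simpa using hℓ)
      _ ≤ d * (2 * dB + 2 * dC + 3) * X N := hmono N (by omega)
  · -- UPDATE rounds: `pairFormer ∘ M₁` behind tag `10`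
    intro N st b hst
    have hcomp := Turing.TM2ComputableAux.comp_outputsWithin R M₁ (hR b st) (h₁ N st b hst)
    have h := (hM _ _ _).2.2.1 hcomp
    refine h.mono (hC1 ?_)
    simp only [List.length_cons]
    have hstX : st.length ≤ X N := hst.trans (hSX N)
    have hm : S N + (dC * st.length + dC) ≤ (2 * dC + 1) * X N := by
      have h1 : dC * st.length ≤ dC * X N := Nat.mul_le_mul_left dC hstX
      have h2 : dC ≤ dC * X N := Nat.le_mul_of_pos_right dC (hX1 N)
      have h3 := hSX N
      calc S N + (dC * st.length + dC) ≤ X N + (dC * X N + dC * X N) := by omega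
        _ = (2 * dC + 1) * X N := by ring
    have hn : st.length + 1 ≤ 1 * X N := by
      have := hSX N; simp only [hX] at this ⊢; omega
    calc d * (S N + (dC * st.length + dC) + (st.length + 1)) + d ≤ d * ((2 * dC + 1) + 1 + 1) * X N :=
          lin_bound (C₁ := 2 * dC + 1) (C₂ := 1) (hX1 N) hm hn
      _ ≤ d * (2 * dB + 2 * dC + 3) * X N := hmono N (by omega)
  · -- ACCEPT round: `M₂` behind tag `11`
    intro N st hst
    have h2 : M₂.OutputsWithin st [A.accept N st] (S N) := h₂ N st hst
    have h := (hM _ _ _).2.2.2 h2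
    refine h.mono (hC1 ?_)
    calc d * (S N + st.length) + d ≤ d * (1 + 1 + 1) * X N :=
          lin_bound (C₁ := 1) (C₂ := 1) (hX1 N) (by simpa using hSX N) (by simpa using hst.trans (hSX N))
      _ ≤ d * (2 * dB + 2 * dC + 3) * X N := hmono N (by omega)
  · -- `S ≤ B`
    intro N
    exact (hSX N).trans (Nat.le_mul_of_pos_left _ (by omega))


end Summit.PneNP.PneNP.Theorems.UniformStreamLB.Birth

end
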